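import Summits.BirchSwinnertonDyer.BirchSwinnertonDyer.Theorems.ClassRecordThreeHsiehDescentUnramifiedPeriod
import HarnessLib

/-!
# Routes `ClassRecordThree` ∕ `KolyvaginRoadThree`, crux `HsiehDescentAtThree` (item stmt-BirchSwinnertonDyer-19108) —
# the crux from {item 19281 (or the reviewed BDP13 fact), ONE `R₀`-period Hsieh witness per datum}: NO Tate–Sen

Cell `bsd-stepL`, seat `bsd-stepL-desc3-p1` (prover g3), `--supports stmt-BirchSwinnertonDyer-19108`. Route-level sequel of
`ClassRecordThreeHsiehDescentUnramifiedPeriod` (`hsiehDescentAt₃_of_inertialReciprocity_of_unrPeriodWitness`).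

* `classRecordThree_hsiehDescentAtThree_of_openValueReciprocityAtThree_of_unrPeriodWitness` (+ Koly copy): crux 19108
  from its child 19281 (SHARP K5-B) and the `R₀`-period Hsieh witnesses — the Tate–Sen child 19238 is NOT used.
* `classRecordThree_hsiehDescentAtThree_of_bdp2013_of_unrPeriodWitness` (+ Koly copy): crux 19108 from the reviewed
  Literature fact `bertoliniDarmonPrasanna2013_centralValue_reciprocity` (p419864; ⟹ 19281 by p421735) and the
  `R₀`-period Hsieh witnesses.
* `unrPeriodWitness_of_hsieh2014_unrPeriod`: those witnesses from the Literature fact (λ-supply is the tree theorem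
  `Three.lambdaSupplyAt₃`); **`classRecordThree_hsiehDescentAtThree_of_bdp2013_of_hsieh2014_unrPeriod`** (+ Koly copy):
  THE END STATE — crux 19108 from exactly the TWO named facts {BDP13 reciprocity, Hsieh 2014 Thm. 5.6 with `Ω_p ∈ 𝒲^×`},
  NO Tate–Sen; and the glue `OpenValueReciprocityAtThree → hsieh♯ → HsiehDescentAtThree` for a re-split of 19108.

The `R₀`-period Hsieh witness hypothesis `hW` (per globally minimal elliptic `W`, node binders VERBATIM, conclusion =
Hsieh 2014 Thm. 5.6's witness with `Ω_p ∈ R₀ˣ`) is the conclusion of Hsieh's theorem with the CM period in its printed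
home `𝒲^× = 𝒪(𝐐̂₃^ur)^×` (Castella–Hsieh 2018 §2.5; Hsieh 2014 p. 23 l. 64) fed with the tree's λ-supply theorem
`Three.lambdaSupplyAt₃`; its Literature typing is the named fact `hsieh2014_exists_anticyclotomicPAdicLFunction_unrPeriod` (p451301; a
sharpening of conjunct 20 of `PublishedInputsThree`, `hsieh2014_exists_anticyclotomicPAdicLFunction`, whose `Ω_p` is
typed in `ℂ₃` with `‖Ω_p‖ = 1` — the sharpened fact implies it, `hsieh2014_exists_anticyclotomicPAdicLFunction_of_unrPeriod`).
NET for the planner (D-0014, nothing edited here): crux 19108 ⟸ {BDP13 reciprocity (print-derived, reviewed), Hsieh 2014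
Thm. 5.6 with `Ω_p ∈ 𝒲^×` (printed)} — the printed Tate–Sen theorem (child 19238) becomes REDUNDANT.

HONEST FRAMING: CONDITIONAL theorems; nothing of K5-B is proved; item 19108 OPEN; no census word (T7); not BSD for any class.
References: [Hsieh2014] Thm. 5.6, p. 23; [CastellaHsieh2018] §2.5; [BertoliniDarmonPrasanna2013] Thm. 5.5; [BrinonConrad2009]
Thm. 2.2.7 (no longer an input on this road).
-/

noncomputable section

set_option linter.dupNamespace false

open scoped NumberField Topology
open Filter NumberField IsDedekindDomain Field PowerSeries WeierstrassCurve
open Literature.NumberTheory.GaloisRepresentations Literature.NumberTheory.EllipticCurves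
open Literature.NumberTheory.EllipticCurves.ModularForms
open Literature.NumberTheory.EllipticCurves.Rank1Residual (Surj Ram)
open Summit.BirchSwinnertonDyer.Rank1Residual Summit.BirchSwinnertonDyer.Rank1Residual.X11b
open Summit.BirchSwinnertonDyer.Rank1Residual.X11b.Three

namespace Summit.BirchSwinnertonDyer.BirchSwinnertonDyer.Theorems

/-- **Crux `HsiehDescentAtThree` (item 19108, route `ClassRecordThree`) from its child 19281 `OpenValueReciprocityAtThree`
(SHARP K5-B) and ONE `R₀`-period Hsieh witness per datum — NO Tate–Sen.** 19281 gives inertial value reciprocity at every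
globally minimal `W` (`inertialReciprocity_of_openValueReciprocityAtThree`, p439048); the core theorem
`hsiehDescentAt₃_of_inertialReciprocity_of_unrPeriodWitness` does the rest on both loci. CONDITIONAL on `h` (item 19281,
open; ⟸ the BDP13 fact) and `hW` (Hsieh 2014 Thm. 5.6 with `Ω_p ∈ 𝒲^×`); item 19108 OPEN.
[cite: Hsieh2014, Thm. 5.6 (arXiv:1112.1580 p. 23)] [cite: CastellaHsieh2018, §2.5 (arXiv:1505.08165 p. 7)] -/
theorem classRecordThree_hsiehDescentAtThree_of_openValueReciprocityAtThree_of_unrPeriodWitness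
    (h : Summit.BirchSwinnertonDyer.BirchSwinnertonDyer.Theses.ClassRecordThree.OpenValueReciprocityAtThree)
    (hW : ∀ (W : WeierstrassCurve ℚ) [W.IsElliptic] [W.IsGloballyMinimal],
  ∀ (ι' : PadicAlgCl 3 ≃+* ℂ) (K : Type) [Field K] [NumberField K]
      (𝔭 : HeightOneSpectrum (𝓞 K)) (κ : ZpExtension K 3) (γ : Field.absoluteGaloisGroup K)
      {N : ℕ} [NeZero N] {f : CuspForm (CongruenceSubgroup.Gamma0 N) 2}, IsNewformOf W f →
      ClassX11b W 3 → Surj W 3 → W.conductorNorm ℤ = N → IsImaginaryQuadratic K →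
      Odd (NumberField.discr K) → SatisfiesHeegnerHypothesis N K →
      ((Ideal.span {(3 : ℤ)}).primesOver (𝓞 K)).ncard = 2 → ((3 : ℕ) : 𝓞 K) ∈ 𝔭.asIdeal →
      𝔭.asIdeal.ramificationIdx (𝓞 ℚ) = 1 → 𝔭.asIdeal.inertiaDeg (𝓞 ℚ) = 1 →
      (∀ (w : InfinitePlace K) (k : 𝓞 K), k ∈ 𝔭.asIdeal ↔ ‖ι'.symm (w.embedding (k : K))‖ < 1) →
      (∀ ℓ : ℕ, ℓ.Prime → ℓ ∣ N → ∃ v : HeightOneSpectrum (𝓞 K), Ideal.absNorm v.asIdeal = ℓ) →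
      κ.IsAnticyclotomic → κ.IsTopGenerator γ →
      ∃ (A : ℝ) (ΩK C : ℂ) (Ωp : (unrIntegers 3)ˣ) (Q : PowerSeries (PadicComplexInt 3)),
        0 < A ∧ ΩK ≠ 0 ∧ ‖((ι'.symm C : PadicAlgCl 3) : ℂ_[3])‖ = 1 ∧
        IsHsiehLFunction ι' 𝔭 κ γ f A ΩK C ((Ωp : unrIntegers 3) : ℂ_[3]) Q) :
    Summit.BirchSwinnertonDyer.BirchSwinnertonDyer.Theses.ClassRecordThree.HsiehDescentAtThree := by
  intro W _ _ _
  have hcore := hsiehDescentAt₃_of_inertialReciprocity_of_unrPeriodWitness W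
    (inertialReciprocity_of_openValueReciprocityAtThree h W) (hW W)
  exact ⟨fun _ _ ↦ hcore, fun _ _ ↦ hcore⟩

/-- **The `KolyvaginRoadThree` copy**: the shared crux 19108 from the shared child 19281 and the `R₀`-period Hsieh
witnesses, NO Tate–Sen (the two routes' decls are definitionally equal). [cite: Hsieh2014, Thm. 5.6 (arXiv:1112.1580 p. 23)] -/
theorem kolyvaginRoadThree_hsiehDescentAtThree_of_openValueReciprocityAtThree_of_unrPeriodWitness
    (h : Summit.BirchSwinnertonDyer.BirchSwinnertonDyer.Theses.KolyvaginRoadThree.OpenValueReciprocityAtThree)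
    (hW : ∀ (W : WeierstrassCurve ℚ) [W.IsElliptic] [W.IsGloballyMinimal],
  ∀ (ι' : PadicAlgCl 3 ≃+* ℂ) (K : Type) [Field K] [NumberField K]
      (𝔭 : HeightOneSpectrum (𝓞 K)) (κ : ZpExtension K 3) (γ : Field.absoluteGaloisGroup K)
      {N : ℕ} [NeZero N] {f : CuspForm (CongruenceSubgroup.Gamma0 N) 2}, IsNewformOf W f →
      ClassX11b W 3 → Surj W 3 → W.conductorNorm ℤ = N → IsImaginaryQuadratic K →
      Odd (NumberField.discr K) → SatisfiesHeegnerHypothesis N K →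
      ((Ideal.span {(3 : ℤ)}).primesOver (𝓞 K)).ncard = 2 → ((3 : ℕ) : 𝓞 K) ∈ 𝔭.asIdeal →
      𝔭.asIdeal.ramificationIdx (𝓞 ℚ) = 1 → 𝔭.asIdeal.inertiaDeg (𝓞 ℚ) = 1 →
      (∀ (w : InfinitePlace K) (k : 𝓞 K), k ∈ 𝔭.asIdeal ↔ ‖ι'.symm (w.embedding (k : K))‖ < 1) →
      (∀ ℓ : ℕ, ℓ.Prime → ℓ ∣ N → ∃ v : HeightOneSpectrum (𝓞 K), Ideal.absNorm v.asIdeal = ℓ) →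
      κ.IsAnticyclotomic → κ.IsTopGenerator γ →
      ∃ (A : ℝ) (ΩK C : ℂ) (Ωp : (unrIntegers 3)ˣ) (Q : PowerSeries (PadicComplexInt 3)),
        0 < A ∧ ΩK ≠ 0 ∧ ‖((ι'.symm C : PadicAlgCl 3) : ℂ_[3])‖ = 1 ∧
        IsHsiehLFunction ι' 𝔭 κ γ f A ΩK C ((Ωp : unrIntegers 3) : ℂ_[3]) Q) :
    Summit.BirchSwinnertonDyer.BirchSwinnertonDyer.Theses.KolyvaginRoadThree.HsiehDescentAtThree :=
  classRecordThree_hsiehDescentAtThree_of_openValueReciprocityAtThree_of_unrPeriodWitness h hW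

/-- **Crux 19108 from the reviewed Literature fact `bertoliniDarmonPrasanna2013_centralValue_reciprocity` (BDP13 Thm. 5.5
with its proof; p419864) and the `R₀`-period Hsieh witnesses — NO Tate–Sen** (the fact ⟹ item 19281 by
`openValueReciprocityAtThree_of_bdp2013`, p421735). CONDITIONAL on the named fact and on `hW`; item 19108 OPEN.
[cite: BertoliniDarmonPrasanna2013, Thm. 5.5 and (5.1.16) (p. 60)] [cite: Hsieh2014, Thm. 5.6 (arXiv:1112.1580 p. 23)] -/
theorem classRecordThree_hsiehDescentAtThree_of_bdp2013_of_unrPeriodWitness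
    (hBDP : bertoliniDarmonPrasanna2013_centralValue_reciprocity)
    (hW : ∀ (W : WeierstrassCurve ℚ) [W.IsElliptic] [W.IsGloballyMinimal],
  ∀ (ι' : PadicAlgCl 3 ≃+* ℂ) (K : Type) [Field K] [NumberField K]
      (𝔭 : HeightOneSpectrum (𝓞 K)) (κ : ZpExtension K 3) (γ : Field.absoluteGaloisGroup K)
      {N : ℕ} [NeZero N] {f : CuspForm (CongruenceSubgroup.Gamma0 N) 2}, IsNewformOf W f →
      ClassX11b W 3 → Surj W 3 → W.conductorNorm ℤ = N → IsImaginaryQuadratic K →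
      Odd (NumberField.discr K) → SatisfiesHeegnerHypothesis N K →
      ((Ideal.span {(3 : ℤ)}).primesOver (𝓞 K)).ncard = 2 → ((3 : ℕ) : 𝓞 K) ∈ 𝔭.asIdeal →
      𝔭.asIdeal.ramificationIdx (𝓞 ℚ) = 1 → 𝔭.asIdeal.inertiaDeg (𝓞 ℚ) = 1 →
      (∀ (w : InfinitePlace K) (k : 𝓞 K), k ∈ 𝔭.asIdeal ↔ ‖ι'.symm (w.embedding (k : K))‖ < 1) →
      (∀ ℓ : ℕ, ℓ.Prime → ℓ ∣ N → ∃ v : HeightOneSpectrum (𝓞 K), Ideal.absNorm v.asIdeal = ℓ) →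
      κ.IsAnticyclotomic → κ.IsTopGenerator γ →
      ∃ (A : ℝ) (ΩK C : ℂ) (Ωp : (unrIntegers 3)ˣ) (Q : PowerSeries (PadicComplexInt 3)),
        0 < A ∧ ΩK ≠ 0 ∧ ‖((ι'.symm C : PadicAlgCl 3) : ℂ_[3])‖ = 1 ∧
        IsHsiehLFunction ι' 𝔭 κ γ f A ΩK C ((Ωp : unrIntegers 3) : ℂ_[3]) Q) :
    Summit.BirchSwinnertonDyer.BirchSwinnertonDyer.Theses.ClassRecordThree.HsiehDescentAtThree :=
  classRecordThree_hsiehDescentAtThree_of_openValueReciprocityAtThree_of_unrPeriodWitness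
    (openValueReciprocityAtThree_of_bdp2013 hBDP) hW

/-- **The `KolyvaginRoadThree` copy**: the shared crux from {the BDP13 fact, the `R₀`-period Hsieh witnesses}, NO
Tate–Sen. [cite: BertoliniDarmonPrasanna2013, Thm. 5.5 and (5.1.16) (p. 60)] -/
theorem kolyvaginRoadThree_hsiehDescentAtThree_of_bdp2013_of_unrPeriodWitness
    (hBDP : bertoliniDarmonPrasanna2013_centralValue_reciprocity)
    (hW : ∀ (W : WeierstrassCurve ℚ) [W.IsElliptic] [W.IsGloballyMinimal],
  ∀ (ι' : PadicAlgCl 3 ≃+* ℂ) (K : Type) [Field K] [NumberField K]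
      (𝔭 : HeightOneSpectrum (𝓞 K)) (κ : ZpExtension K 3) (γ : Field.absoluteGaloisGroup K)
      {N : ℕ} [NeZero N] {f : CuspForm (CongruenceSubgroup.Gamma0 N) 2}, IsNewformOf W f →
      ClassX11b W 3 → Surj W 3 → W.conductorNorm ℤ = N → IsImaginaryQuadratic K →
      Odd (NumberField.discr K) → SatisfiesHeegnerHypothesis N K →
      ((Ideal.span {(3 : ℤ)}).primesOver (𝓞 K)).ncard = 2 → ((3 : ℕ) : 𝓞 K) ∈ 𝔭.asIdeal →
      𝔭.asIdeal.ramificationIdx (𝓞 ℚ) = 1 → 𝔭.asIdeal.inertiaDeg (𝓞 ℚ) = 1 →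
      (∀ (w : InfinitePlace K) (k : 𝓞 K), k ∈ 𝔭.asIdeal ↔ ‖ι'.symm (w.embedding (k : K))‖ < 1) →
      (∀ ℓ : ℕ, ℓ.Prime → ℓ ∣ N → ∃ v : HeightOneSpectrum (𝓞 K), Ideal.absNorm v.asIdeal = ℓ) →
      κ.IsAnticyclotomic → κ.IsTopGenerator γ →
      ∃ (A : ℝ) (ΩK C : ℂ) (Ωp : (unrIntegers 3)ˣ) (Q : PowerSeries (PadicComplexInt 3)),
        0 < A ∧ ΩK ≠ 0 ∧ ‖((ι'.symm C : PadicAlgCl 3) : ℂ_[3])‖ = 1 ∧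
        IsHsiehLFunction ι' 𝔭 κ γ f A ΩK C ((Ωp : unrIntegers 3) : ℂ_[3]) Q) :
    Summit.BirchSwinnertonDyer.BirchSwinnertonDyer.Theses.KolyvaginRoadThree.HsiehDescentAtThree :=
  classRecordThree_hsiehDescentAtThree_of_bdp2013_of_unrPeriodWitness hBDP hW

/-! ### The `R₀`-period Hsieh witnesses from the Literature fact with `Ω_p ∈ 𝒲^×`, and the end state of item 19108 -/

/-- **The sharpened Hsieh fact implies the original one** (`Ω_p ∈ R₀ˣ` has norm one: a unit of `R₀ ⊆ 𝓞_{ℂ_p}` and its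
inverse both have norm `≤ 1`). [cite: Hsieh2014, Thm. 5.6 (arXiv:1112.1580 p. 23)] [cite: CastellaHsieh2018, §2.5 (arXiv:1505.08165 p. 7)] -/
theorem hsieh2014_exists_anticyclotomicPAdicLFunction_of_unrPeriod
    (h : hsieh2014_exists_anticyclotomicPAdicLFunction_unrPeriod) :
    hsieh2014_exists_anticyclotomicPAdicLFunction := by
  intro p _ ι K _ _ 𝔭 κ γ N _ f lam rlam hp2 hnf hN hK hsplit h𝔭 hι hHeeg hunit hinf hAQ hunr hav hfac hκ hγ
  obtain ⟨A, ΩK, C, Ωp, Q, hA, hΩK, hC, hQ⟩ :=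
    h ι K 𝔭 κ γ f lam rlam hp2 hnf hN hK hsplit h𝔭 hι hHeeg hunit hinf hAQ hunr hav hfac hκ hγ
  exact ⟨A, ΩK, C, ((Ωp : unrIntegers p) : ℂ_[p]), Q, hA, hΩK, hC,
    (unrIntegers.isUnit_iff_norm_eq_one _).1 Ωp.isUnit, hQ⟩

/-- **The support item `HsiehAnticyclotomicPAdicLFunction` (conjunct 20 of `PublishedInputsThree`, by name) from the
sharpened fact** — so citing Hsieh 2014 Thm. 5.6 with `Ω_p ∈ 𝒲^×` subsumes the route's existing Hsieh input.
[cite: Hsieh2014, Thm. 5.6 (arXiv:1112.1580 p. 23)] -/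
theorem classRecordThree_hsiehAnticyclotomicPAdicLFunction_of_unrPeriod
    (h : hsieh2014_exists_anticyclotomicPAdicLFunction_unrPeriod) :
    Summit.BirchSwinnertonDyer.BirchSwinnertonDyer.Theses.ClassRecordThree.HsiehAnticyclotomicPAdicLFunction :=
  hsieh2014_exists_anticyclotomicPAdicLFunction_of_unrPeriod h

/-- The `KolyvaginRoadThree` copy of the previous theorem. [cite: Hsieh2014, Thm. 5.6 (arXiv:1112.1580 p. 23)] -/
theorem kolyvaginRoadThree_hsiehAnticyclotomicPAdicLFunction_of_unrPeriod
    (h : hsieh2014_exists_anticyclotomicPAdicLFunction_unrPeriod) :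
    Summit.BirchSwinnertonDyer.BirchSwinnertonDyer.Theses.KolyvaginRoadThree.HsiehAnticyclotomicPAdicLFunction :=
  hsieh2014_exists_anticyclotomicPAdicLFunction_of_unrPeriod h

/-- **The `R₀`-period Hsieh witnesses at every datum of the node, from the sharpened Literature fact** (Hsieh 2014
Thm. 5.6 with `Ω_p ∈ 𝒲^×`) fed — exactly as x11b3's `bdpExistsAt₃_of_hsieh2014` feeds the original fact — with the
tree's λ-supply theorem `Three.lambdaSupplyAt₃` (`3 ≠ 2`; `IsNewformOf ⇒ IsNewform0`; `3 ∥ N_E` from `ClassX11b W 3`;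
the datum's `K, 𝔭, ι′, κ, γ`). CONDITIONAL on the named fact only. [cite: Hsieh2014, Thm. 5.6 (arXiv:1112.1580 p. 23)] -/
theorem unrPeriodWitness_of_hsieh2014_unrPeriod (hH : hsieh2014_exists_anticyclotomicPAdicLFunction_unrPeriod)
    (W : WeierstrassCurve ℚ) [W.IsElliptic] [W.IsGloballyMinimal] :
  ∀ (ι' : PadicAlgCl 3 ≃+* ℂ) (K : Type) [Field K] [NumberField K]
      (𝔭 : HeightOneSpectrum (𝓞 K)) (κ : ZpExtension K 3) (γ : Field.absoluteGaloisGroup K)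
      {N : ℕ} [NeZero N] {f : CuspForm (CongruenceSubgroup.Gamma0 N) 2}, IsNewformOf W f →
      ClassX11b W 3 → Surj W 3 → W.conductorNorm ℤ = N → IsImaginaryQuadratic K →
      Odd (NumberField.discr K) → SatisfiesHeegnerHypothesis N K →
      ((Ideal.span {(3 : ℤ)}).primesOver (𝓞 K)).ncard = 2 → ((3 : ℕ) : 𝓞 K) ∈ 𝔭.asIdeal →
      𝔭.asIdeal.ramificationIdx (𝓞 ℚ) = 1 → 𝔭.asIdeal.inertiaDeg (𝓞 ℚ) = 1 →
      (∀ (w : InfinitePlace K) (k : 𝓞 K), k ∈ 𝔭.asIdeal ↔ ‖ι'.symm (w.embedding (k : K))‖ < 1) →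
      (∀ ℓ : ℕ, ℓ.Prime → ℓ ∣ N → ∃ v : HeightOneSpectrum (𝓞 K), Ideal.absNorm v.asIdeal = ℓ) →
      κ.IsAnticyclotomic → κ.IsTopGenerator γ →
      ∃ (A : ℝ) (ΩK C : ℂ) (Ωp : (unrIntegers 3)ˣ) (Q : PowerSeries (PadicComplexInt 3)),
        0 < A ∧ ΩK ≠ 0 ∧ ‖((ι'.symm C : PadicAlgCl 3) : ℂ_[3])‖ = 1 ∧
        IsHsiehLFunction ι' 𝔭 κ γ f A ΩK C ((Ωp : unrIntegers 3) : ℂ_[3]) Q := by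
  haveI : Fact (Nat.Prime 3) := ⟨Nat.prime_three⟩
  intro ι' K _ _ 𝔭 κ γ N _ f hnf hX _hsurj hN hK _hodd hHeeg h3 h𝔭 _he _hf hι' _hHeegC hκ hγ
  obtain ⟨lam, rlam, hunit, hinfl, hAQ, hunrl, havl, hfacl⟩ := lambdaSupplyAt₃ ι' K κ hK h3 hκ
  have h9 : ¬ 3 ^ 2 ∣ N := hN ▸ not_sq_dvd_conductorNorm_of_mult W 3 hX.2.2.1
  exact hH ι' K 𝔭 κ γ f lam rlam (by norm_num) hnf.1 h9 hK h3 h𝔭 hι' hHeeg hunit hinfl hAQ hunrl havl hfacl hκ hγ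

/-- **END STATE OF ITEM 19108 (route `ClassRecordThree`) WITHOUT TATE–SEN: the crux from exactly TWO Literature named
facts — the reviewed BDP13 reciprocity (`bertoliniDarmonPrasanna2013_centralValue_reciprocity`, p419864) and Hsieh 2014
Thm. 5.6 with its `p`-adic CM period in `𝒲^×` (`hsieh2014_exists_anticyclotomicPAdicLFunction_unrPeriod`).** The second
is a sharper typing of a fact the route already cites (conjunct 20 of `PublishedInputsThree`); the Tate–Sen child 19238
is not used. CONDITIONAL on the two named facts; item 19108 OPEN (not closed by a conditional theorem); no census word.
[cite: BertoliniDarmonPrasanna2013, Thm. 5.5 and (5.1.16) (p. 60)] [cite: Hsieh2014, Thm. 5.6 (arXiv:1112.1580 p. 23)]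
[cite: CastellaHsieh2018, §2.5 (arXiv:1505.08165 p. 7)] -/
theorem classRecordThree_hsiehDescentAtThree_of_bdp2013_of_hsieh2014_unrPeriod
    (hBDP : bertoliniDarmonPrasanna2013_centralValue_reciprocity)
    (hH : hsieh2014_exists_anticyclotomicPAdicLFunction_unrPeriod) :
    Summit.BirchSwinnertonDyer.BirchSwinnertonDyer.Theses.ClassRecordThree.HsiehDescentAtThree :=
  classRecordThree_hsiehDescentAtThree_of_bdp2013_of_unrPeriodWitness hBDP
    (fun W _ _ ↦ unrPeriodWitness_of_hsieh2014_unrPeriod hH W)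

/-- **The `KolyvaginRoadThree` copy of the end state**: the shared crux 19108 from {BDP13 reciprocity, Hsieh 2014 Thm. 5.6
with `Ω_p ∈ 𝒲^×`}, no Tate–Sen. [cite: BertoliniDarmonPrasanna2013, Thm. 5.5 and (5.1.16) (p. 60)]
[cite: Hsieh2014, Thm. 5.6 (arXiv:1112.1580 p. 23)] -/
theorem kolyvaginRoadThree_hsiehDescentAtThree_of_bdp2013_of_hsieh2014_unrPeriod
    (hBDP : bertoliniDarmonPrasanna2013_centralValue_reciprocity)
    (hH : hsieh2014_exists_anticyclotomicPAdicLFunction_unrPeriod) :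
    Summit.BirchSwinnertonDyer.BirchSwinnertonDyer.Theses.KolyvaginRoadThree.HsiehDescentAtThree :=
  classRecordThree_hsiehDescentAtThree_of_bdp2013_of_hsieh2014_unrPeriod hBDP hH

/-- **Item 19108 from its child 19281 and the sharpened Hsieh fact** (the glue the planner needs if 19108 is re-split into
{`OpenValueReciprocityAtThree`, a cite-only child := `hsieh2014_exists_anticyclotomicPAdicLFunction_unrPeriod`}):
`OpenValueReciprocityAtThree → hsieh♯ → HsiehDescentAtThree`. CONDITIONAL; OPEN. [cite: Hsieh2014, Thm. 5.6 (arXiv:1112.1580 p. 23)] -/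
theorem classRecordThree_hsiehDescentAtThree_of_openValueReciprocityAtThree_of_hsieh2014_unrPeriod
    (h : Summit.BirchSwinnertonDyer.BirchSwinnertonDyer.Theses.ClassRecordThree.OpenValueReciprocityAtThree)
    (hH : hsieh2014_exists_anticyclotomicPAdicLFunction_unrPeriod) :
    Summit.BirchSwinnertonDyer.BirchSwinnertonDyer.Theses.ClassRecordThree.HsiehDescentAtThree :=
  classRecordThree_hsiehDescentAtThree_of_openValueReciprocityAtThree_of_unrPeriodWitness h
    (fun W _ _ ↦ unrPeriodWitness_of_hsieh2014_unrPeriod hH W)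

/-- **The `KolyvaginRoadThree` copy**: `OpenValueReciprocityAtThree → hsieh♯ → HsiehDescentAtThree` for the shared items.
[cite: Hsieh2014, Thm. 5.6 (arXiv:1112.1580 p. 23)] -/
theorem kolyvaginRoadThree_hsiehDescentAtThree_of_openValueReciprocityAtThree_of_hsieh2014_unrPeriod
    (h : Summit.BirchSwinnertonDyer.BirchSwinnertonDyer.Theses.KolyvaginRoadThree.OpenValueReciprocityAtThree)
    (hH : hsieh2014_exists_anticyclotomicPAdicLFunction_unrPeriod) :
    Summit.BirchSwinnertonDyer.BirchSwinnertonDyer.Theses.KolyvaginRoadThree.HsiehDescentAtThree :=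
  classRecordThree_hsiehDescentAtThree_of_openValueReciprocityAtThree_of_hsieh2014_unrPeriod h hH

end Summit.BirchSwinnertonDyer.BirchSwinnertonDyer.Theorems

end
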